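import Summits.RiemannHypothesis.RiemannHypothesis.Theorems.JensenPolynomialsFarGumbelShift
import Summits.RiemannHypothesis.RiemannHypothesis.Theorems.JensenPolynomialsFarGumbelPhase
import Summits.RiemannHypothesis.RiemannHypothesis.Theorems.JensenPolynomialsCubicWindow

/-!
# Route `JensenPolynomials`, FAR crux `XiWindowZeroFreeRelFar` (B1-rel far) — S3 step 4: the window hypothesis (W) of the
master assembly from ONE scalar bound `|Ψ‴| ≤ K` on the window segment, and the connector bound (C) from a pointwise sup
(RH-FREE; cell rh-jensen, HUMAN RULING D-0040)

For `FarGumbel.laplaceFar_of_pointwise` (`JensenPolynomialsFarGumbelAssembly.lean`, item `stmt-RiemannHypothesis-19465`, stub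
S3): along the line `Im u = y_s` the phase `P(x) = Ψ(x + iy_s)` (`Ψ = farPsi M a`) has `x`-derivatives `Ψ′, Ψ″, Ψ‴` at `x + iy_s`
(`farPsi1/2/3`, `JensenPolynomialsFarGumbelPhase`); so by the Taylor brick `WindowEGF.cubic_window_of_hasDerivAt` the drifted
cubic window hypothesis (W) holds with `b = Ψ′(u_s)`, `c = −Ψ″(u_s)/2`, `M_c = K/6` as soon as `‖Ψ‴(x+iy_s)‖ ≤ K` for
`|x − x_s| ≤ δ` (`window_of_farPsi3_le`). Also: the vertical connector integral at `Re u = υ − 2` is at most `|y_s|` times a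
pointwise bound of the integrand (`connector_le_of_pointwise`).
WHAT THIS IS NOT: calculus bookkeeping; nothing here bears on the zeros of `ζ` or the truth of RH.
-/

noncomputable section
-- D-0017: `Summit.RiemannHypothesis.RiemannHypothesis.…` duplicates the namespace BY DESIGN (single-problem summit).
set_option linter.dupNamespace false

namespace Summit.RiemannHypothesis.RiemannHypothesis.Theorems.JensenPolynomials.FarGumbel

open Literature.NumberTheory.LFunctions MeasureTheory Set Filter Complex
open Summit.RiemannHypothesis.RiemannHypothesis.Theorems.JensenPolynomials.WindowEGF
open scoped Real

/-- Derivatives of the phase ALONG A HORIZONTAL LINE: if `Ψ` has complex derivative `Ψ′(u)` at `u = x + iy`, then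
`x ↦ Ψ(x + iy)` has real derivative `Ψ′(x + iy)` at `x`. -/
theorem hasDerivAt_line {Φ : ℂ → ℂ} {Φ' : ℂ} {x y : ℝ} (h : HasDerivAt Φ Φ' ((x : ℂ) + y * I)) :
    HasDerivAt (fun t : ℝ => Φ ((t : ℂ) + y * I)) Φ' x := by
  have hl : HasDerivAt (fun t : ℂ => t + y * I) 1 (x : ℂ) := by
    simpa using (hasDerivAt_id (x : ℂ)).add_const ((y : ℂ) * I)
  have := (h.comp (x : ℂ) hl).comp_ofReal
  simpa using this

/-- **(W) from `|Ψ‴| ≤ K`.** On the window segment `{x + iy_s : |x − x_s| ≤ δ}` inside the half-strip (`υ − 2 ≤ x_s − δ`,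
`|y_s| ≤ 1/10`, `υ ≥ 189/20`, `‖a‖ ≤ (9/25)υ²`), a bound `‖Ψ‴(x + iy_s)‖ ≤ K` gives the drifted cubic window hypothesis of the
master assembly with `b = Ψ′(u_s)`, `c = −Ψ″(u_s)/2`, `M_c = K/6` (`u_s = x_s + iy_s`). -/
theorem window_of_farPsi3_le (M : ℕ) {υ : ℝ} (hυ : (189 / 20 : ℝ) ≤ υ) {a : ℂ} (ha : ‖a‖ ≤ (9 / 25 : ℝ) * υ ^ 2)
    {x_s y_s δ K : ℝ} (hy : |y_s| ≤ 1 / 10) (hxs : υ - 2 ≤ x_s - δ)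
    (hK : ∀ x : ℝ, |x - x_s| ≤ δ → ‖farPsi3 M a (x + y_s * I)‖ ≤ K) :
    ∀ x : ℝ, |x - x_s| ≤ δ →
      ‖farPsi M a (x + y_s * I) - farPsi M a (x_s + y_s * I) - farPsi1 M a (x_s + y_s * I) * (x - x_s) +
          (-(farPsi2 M a (x_s + y_s * I) / 2)) * (x - x_s) ^ 2‖ ≤ K / 6 * |x - x_s| ^ 3 := by
  have hgeo : ∀ x : ℝ, |x - x_s| ≤ δ → 0 < ((x : ℂ) + y_s * I).re ∧ ((x : ℂ) + y_s * I) ^ 2 + a ∈ slitPlane := by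
    intro x hx
    have hx' : υ - 2 ≤ x := by linarith [(abs_le.mp hx).1]
    refine ⟨?_, sq_add_mem_slitPlane hυ ha hx' hy⟩
    have : ((x : ℂ) + y_s * I).re = x := by simp
    rw [this]; linarith
  exact cubic_window_of_hasDerivAt (P := fun x : ℝ => farPsi M a (x + y_s * I))
    (P₁ := fun x : ℝ => farPsi1 M a (x + y_s * I)) (P₂ := fun x : ℝ => farPsi2 M a (x + y_s * I))
    (P₃ := fun x : ℝ => farPsi3 M a (x + y_s * I))
    (fun x hx => hasDerivAt_line (hasDerivAt_farPsi M a (hgeo x hx).1 (hgeo x hx).2))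
    (fun x hx => hasDerivAt_line (hasDerivAt_farPsi1 M a (hgeo x hx).1 (hgeo x hx).2))
    (fun x hx => hasDerivAt_line (hasDerivAt_farPsi2 M a (hgeo x hx).1 (hgeo x hx).2)) hK

/-- **(C) from a pointwise bound.** If the connector integrand is bounded by `B` on the segment `υ − 2 + it`, `t ∈ [[0, y_s]]`,
then the connector integral has norm `≤ B·|y_s|`. -/
theorem connector_le_of_pointwise (M : ℕ) {υ : ℝ} {a : ℂ} {y_s B : ℝ}
    (hB : ∀ t ∈ uIcc (0 : ℝ) y_s, ‖deBruijnPhiC ((υ - 2 : ℝ) + t * I) *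
        ((((υ - 2 : ℝ) : ℂ) + t * I) * ((((υ - 2 : ℝ) : ℂ) + t * I) ^ 2 + a) ^ ((M : ℂ) - 1 / 2))‖ ≤ B) :
    ‖∫ t in (0 : ℝ)..y_s, deBruijnPhiC ((υ - 2 : ℝ) + t * I) *
        ((((υ - 2 : ℝ) : ℂ) + t * I) * ((((υ - 2 : ℝ) : ℂ) + t * I) ^ 2 + a) ^ ((M : ℂ) - 1 / 2))‖ ≤ B * |y_s| := by
  have h := intervalIntegral.norm_integral_le_of_norm_le_const (a := (0 : ℝ)) (b := y_s)
    (f := fun t : ℝ => deBruijnPhiC ((υ - 2 : ℝ) + t * I) *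
        ((((υ - 2 : ℝ) : ℂ) + t * I) * ((((υ - 2 : ℝ) : ℂ) + t * I) ^ 2 + a) ^ ((M : ℂ) - 1 / 2))) (C := B)
    (fun t ht => hB t (by
      rcases le_total 0 y_s with h0 | h0
      · rw [uIoc_of_le h0] at ht; rw [uIcc_of_le h0]; exact ⟨ht.1.le, ht.2⟩
      · rw [uIoc_of_ge h0] at ht; rw [uIcc_of_ge h0]; exact ⟨ht.1.le, ht.2⟩))
  simpa using h

end Summit.RiemannHypothesis.RiemannHypothesis.Theorems.JensenPolynomials.FarGumbel

end
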